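import Literature.IUT.HodgeTheaters.PMBaseProcessions
import Mathlib.CategoryTheory.Pi.Basic

/-!
# [IUTchI] §5, Definition 5.2 (i)–(iv), Remarks 5.2.1–5.2.2, Corollary 5.3 (ii)–(iv), Remark 5.3.1: prime-strips

Mochizuki, *Inter-universal Teichmüller theory I*, §5 "ΘNF-Hodge Theaters": Definition 5.2 (i)–(iv)
pp. 134–135, Remark 5.2.1 (i), (ii) p. 143, Remark 5.2.2 p. 143, Corollary 5.3 (ii)–(iv) p. 144, the
discussion preceding Example 5.4 pp. 146–147, Corollary 5.6 (i) p. 153, kurims manuscript (May 2020)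
([IUTchI] Def 5.2 pp.134-135) [claim: Mochizuki2012, status: disputed].

The Frobenioid-theoretic ("holomorphic Frobenioid-", `ℱ`-) prime-strips are collections, indexed by
`v ∈ 𝕍`, of isomorphs of the model local data `ℱ_v` of [IUTchI] Examples 3.2 (iii), 3.3 (i), 3.4 (i)
(`p_v`-adic / archimedean Frobenioids with Kummer structure) — abc-iut-L5-t2's §3 over the Frobenioids
of abc-iut-L1. As for the base (`𝒟`-) prime-strips (`PMBaseKit.lean`), the models and the categories in
which their isomorphs live are packaged as an INTERFACE `FKit K` over the base kit (fields quote
print; TODO-merge:abc-iut-L5-t2 / abc-iut-L1-*), and the notions of §5 are DEFINED over it: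

* Def 5.2 (i) `ℱ`-prime-strips, (ii) `ℱ^⊢`-prime-strips, (iii) their morphisms (collections of
  isomorphisms) and capsules, (iv) `ℱ^⊩`-prime-strips (globally realified);
* Rmk 5.2.1 (i) the functorial algorithms `ℱ ↦ 𝒟` (associated `𝒟`-prime-strip), `ℱ^⊢ ↦ 𝒟^⊢`, (ii)
  `ℱ ↦ ℱ^⊢` (mono-analyticization) and `ℱ ↦ ℱ^⊩`;
* Cor 5.3 (ii) `Isom(¹𝔉, ²𝔉) → Isom(¹𝔇, ²𝔇)` bijective, (iii) `Isom(¹𝔉^⊢, ²𝔉^⊢) → Isom(¹𝔇^⊢, ²𝔇^⊢)` surjective,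
  (iv) `Aut(ℱ̲_v) → Aut(𝒟_v)` bijective for `v ∈ 𝕍^bad`, as named `Prop` statements (these are IUT's
  rigidity assertions resting on [AbsTopIII] Prop 3.2 (iv), 4.2 (i), 5.8 (ii), (v) and [EtTh]; never
  asserted here);
* Θ-Hodge theaters ([IUTchI] Def 3.6 p. 87, abc-iut-L5-t2's; minimal local version TODO-merge), the
  `ℱ`-prime-strip `†𝔉_>` "tautologically associated to" one (p. 147) and the induced map on isomorphisms
  (Cor 5.6 itself is abc-iut-L5-t3's node);
* Rmk 5.3.1: the poly-morphism of `ℱ`-prime-strips "uniquely determined by" a poly-morphism of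
  `𝒟`-prime-strips (`liftPoly`; bijectivity PROVED from Cor 5.3 (ii)).

Rmk 5.2.2 ("`ℱ`-prime-strips are Kummer-ready, `ℱ^⊢`-prime-strips are Kummer-blind") is terminology
(Rmk 5.1.3) recorded in the docstrings of `FStrip` / `FmStrip`. Def 5.2 (v)–(viii) (local
`∞κ`-coric structures) are in `FPrimeStripsCoric.lean`.
-/

namespace Literature.IUT.HodgeTheaters

open CategoryTheory

universe u

namespace PMBaseKit

variable {l : ℕ} (K : PMBaseKit.{u} l)

/-- **The Frobenioid-level interface of [IUTchI] §5** over the base kit: the model local data of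
Examples 3.2–3.5 / Def 3.6 and the categories in which their isomorphs and isomorphisms live,
together with the functorial algorithms of Remark 5.2.1 (TODO-merge:abc-iut-L5-t2 for §3,
abc-iut-L1-* for Frobenioids, abc-iut-L5-t3 for `𝒟^⊢`). Every field quotes print.
([IUTchI] Def 5.2 (i)-(iv) pp.134-135) [claim: Mochizuki2012, status: disputed] -/
structure FKit (M : K.MultKit) where
  /-- the ambient category at `v` of "collections of data" of the type of `ℱ_v`: for `v ∈ 𝕍^non`
  categories (Frobenioids) and equivalences up to isomorphism, for `v ∈ 𝕍^arc` triples
  `(𝒞_v, 𝒟_v, κ_v)` "consisting of a category, an Aut-holomorphic orbispace, and a Kummer structure"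
  and isomorphisms of collections of data ([IUTchI] Def 5.2 (i) p. 134) -/
  FAmb : K.V → Type u
  /-- category structure -/
  [catF : ∀ v, Category.{u} (FAmb v)]
  /-- the model `ℱ_v`: "`𝒞_v` as in Examples 3.2, (iii); 3.3, (i)" for `v ∈ 𝕍^non`,
  "`ℱ_v = (𝒞_v, 𝒟_v, κ_v)` as in Example 3.4, (i)" for `v ∈ 𝕍^arc` ([IUTchI] Def 5.2 (i) p. 134;
  TODO-merge:abc-iut-L5-t2) -/
  fModel : ∀ v, FAmb v
  /-- the ambient category at `v` of data of the type of `ℱ^⊢_v`: "a split Frobenioid, whose underlying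
  Frobenioid we denote by `‡𝒞^⊢_v`" (`v ∈ 𝕍^non`) / "a triple of data, consisting of a Frobenioid `‡𝒞^⊢_v`,
  an object of `𝕋𝕄^⊢`, and a splitting of the Frobenioid" (`v ∈ 𝕍^arc`) ([IUTchI] Def 5.2 (ii) p. 134) -/
  FmAmb : K.V → Type u
  /-- category structure -/
  [catFm : ∀ v, Category.{u} (FmAmb v)]
  /-- the model `ℱ^⊢_v` "as in Examples 3.2, (v); 3.3, (i)" / "Example 3.4, (ii)" ([IUTchI] Def 5.2 (ii)
  p. 134; TODO-merge:abc-iut-L5-t2) -/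
  fmModel : ∀ v, FmAmb v
  /-- Rmk 5.2.1 (i): "a functorial algorithm for constructing `𝒟`- … prime-strips from `ℱ`- …
  prime-strips" ([IUTchI] Rmk 5.2.1 (i) p. 143; from Examples 3.2 (vi) (c), (d); 3.3 (iii) (b), (c)):
  the base object `†𝒟_v` of `†ℱ_v` -/
  toD : ∀ v, FAmb v ⥤ K.Amb v
  /-- the base of the model `ℱ_v` is the model `𝒟_v` -/
  toD_model : ∀ v, (toD v).obj (fModel v) ≅ K.model v
  /-- Rmk 5.2.1 (i): "… `𝒟^⊢`-prime-strips from `ℱ^⊢`-prime-strips": the functor to abc-iut-L5-t3's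
  `𝒟^⊢`-prime-strips is recorded strip-wise below (`toDm`); here the per-`v` shadow is not needed -/
  toFm : ∀ v, FAmb v ⥤ FmAmb v
  /-- the mono-analyticization of the model `ℱ_v` is the model `ℱ^⊢_v` ([IUTchI] Rmk 5.2.1 (ii) p. 143,
  from Examples 3.2 (vi) (f); 3.3 (iii) (e); 3.4 (i), (ii)) -/
  toFm_model : ∀ v, (toFm v).obj (fModel v) ≅ fmModel v
  /-- the ambient category of "collections of data `(‡𝒞^⊩, Prime(‡𝒞^⊩) ⥲ 𝕍, ‡𝔉^⊢, {‡ρ_v}_{v∈𝕍})`"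
  satisfying (a)–(e) of [IUTchI] Def 5.2 (iv) pp. 134–135 ("(a) `‡𝒞^⊩` is a category [which is, in fact,
  equipped with a Frobenioid structure] that is isomorphic to the category `𝒞^⊩_mod` of Example 3.5, (i);
  (b) "`Prime(−)`" is defined as in the discussion of Example 3.5, (i); (c) `Prime(‡𝒞^⊩) ⥲ 𝕍` is a
  bijection of sets; (d) `‡𝔉^⊢ = {‡ℱ^⊢_v}_{v∈𝕍}` is an `ℱ^⊢`-prime-strip; (e) `‡ρ_v : Φ_{‡𝒞^⊩,v} ⥲ Φ^rlf_{‡𝒞^⊢_v}`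
  … is an isomorphism of topological monoids [both of which are, in fact, isomorphic to `ℝ_{≥0}`]")
  and "isomorphism[s] between collections of data" -/
  RlfAmb : Type u
  /-- category structure -/
  [catRlf : Category.{u} RlfAmb]
  /-- the model "collection of data `ℱ^⊩_mod` of Example 3.5, (ii)" ([IUTchI] Def 5.2 (iv) (f) p. 135;
  TODO-merge:abc-iut-L5-t2) -/
  rlfModel : RlfAmb
  /-- the `ℱ^⊢`-prime-strip component (d) of a collection of data, functorially -/
  rlfFm : ∀ v, RlfAmb ⥤ FmAmb v
  /-- Rmk 5.2.1 (ii): "one may also construct from the `ℱ`-prime-strip `‡𝔉`, via a functorial algorithm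
  [cf. the constructions of Example 3.5, (i), (ii)], a collection of data `‡𝔉 ↦ ‡𝔉^⊩`" ([IUTchI] Rmk 5.2.1
  (ii) p. 143): on objects … -/
  rlfOf : (∀ v, FAmb v) → RlfAmb
  /-- … and on isomorphisms (functoriality of the algorithm) -/
  rlfOfMap : ∀ {F₁ F₂ : ∀ v, FAmb v}, (∀ v, F₁ v ≅ F₂ v) → (rlfOf F₁ ≅ rlfOf F₂)
  /-- the `ℱ^⊢`-prime-strip inside `‡𝔉^⊩` is the mono-analyticization of `‡𝔉` (Rmk 5.2.1 (ii) p. 143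
  "consisting of … the `ℱ^⊢`-prime-strip `‡𝔉^⊢`") -/
  rlfFm_rlfOf : ∀ (F : ∀ v, FAmb v) (v), (rlfFm v).obj (rlfOf F) ≅ (toFm v).obj (F v)
  /-- the ambient category at `v ∈ 𝕍^bad` of isomorphs of the tempered Frobenioid `ℱ̲_v` of [IUTchI]
  Example 3.2 (i) p. 69 ("a category which admits an equivalence of categories `†ℱ̲_v ⥲ ℱ̲_v`", Def 3.6
  (a) p. 87); for `v ∈ 𝕍^good` the data of Def 3.6 (a), (b) are those of Def 5.2 (i) (Cor 5.6, proof,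
  p. 154: "for `v ∈ 𝕍^good`, … `†ℱ_{>,v} = †ℱ̲_v`") -/
  ThAmb : K.V → Type u
  /-- category structure -/
  [catTh : ∀ v, Category.{u} (ThAmb v)]
  /-- the model `ℱ̲_v` of Examples 3.2 (i), 3.3 (i), 3.4 (i) (TODO-merge:abc-iut-L5-t2) -/
  thModel : ∀ v, ThAmb v
  /-- "the `ℱ`-prime-strip tautologically associated to this Θ-Hodge theater [cf. the data
  `{†ℱ̲_v}_{v∈𝕍}` of Definition 3.6; Definition 5.2, (i); Example 3.2, (iii); Example 3.3, (i)]"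
  ([IUTchI] p. 147): the local datum of Def 5.2 (i) extracted from `†ℱ̲_v` -/
  thToF : ∀ v, ThAmb v ⥤ FAmb v
  /-- it carries the model to the model -/
  thToF_model : ∀ v, (thToF v).obj (thModel v) ≅ fModel v
  /-- Rmk 5.2.1 (i) for whole strips: the `𝒟^⊢`-prime-strip associated to an `ℱ^⊢`-prime-strip (objects) -/
  toDm : (∀ v, FmAmb v) → M.DMono
  /-- … and isomorphisms -/
  toDmMap : ∀ {F₁ F₂ : ∀ v, FmAmb v}, (∀ v, F₁ v ≅ F₂ v) → (toDm F₁ ⟶ toDm F₂)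
  /-- compatibility `(𝔉 ↦ 𝔉^⊢ ↦ 𝔇^⊢) = (𝔉 ↦ 𝔇 ↦ 𝔇^⊢)` for `ℱ`-prime-strips (Def 4.1 (iv), Rmk 5.2.1) -/
  toDm_toFm : ∀ (F : ∀ v, FAmb v) (hF : ∀ v, Nonempty (F v ≅ fModel v)),
    Nonempty (toDm (fun v => (toFm v).obj (F v)) ⟶
      M.mono ⟨fun v => (toD v).obj (F v), fun v => ⟨(toD v).mapIso (hF v).some ≪≫ toD_model v⟩⟩)

attribute [instance] FKit.catF FKit.catFm FKit.catRlf FKit.catTh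

namespace FKit

variable {K} {M : K.MultKit} {FK : K.FKit M}

/-! ### Def 5.2 (i)–(iii): `ℱ`- and `ℱ^⊢`-prime-strips, morphisms, capsules -/

/-- An **`ℱ`-prime-strip** (holomorphic Frobenioid-prime-strip) `‡𝔉 = {‡ℱ_v}_{v∈𝕍}`: "(a) if `v ∈ 𝕍^non`,
then `‡ℱ_v` is a category `‡𝒞_v` which admits an equivalence of categories `‡𝒞_v ⥲ 𝒞_v` …; (b) if
`v ∈ 𝕍^arc`, then `‡ℱ_v = (‡𝒞_v, ‡𝒟_v, ‡κ_v)` is a collection of data consisting of a category, an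
Aut-holomorphic orbispace, and a Kummer structure such that there exists an isomorphism of collections
of data `‡ℱ_v ⥲ ℱ_v`" ([IUTchI] Def 5.2 (i) p. 134). Kummer-ready (Rmk 5.2.2 p. 143).
([IUTchI] Def 5.2 (i) p.134) [claim: Mochizuki2012, status: disputed] -/
structure FStrip (FK : K.FKit M) where
  /-- the constituent `‡ℱ_v` -/
  obj : ∀ v, FK.FAmb v
  /-- each constituent is an isomorph of the model `ℱ_v` -/
  isModel : ∀ v, Nonempty (obj v ≅ FK.fModel v)

/-- An **`ℱ^⊢`-prime-strip** (mono-analytic Frobenioid-prime-strip) `‡𝔉^⊢ = {‡ℱ^⊢_v}_{v∈𝕍}`: "(a) if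
`v ∈ 𝕍^non`, then `‡ℱ^⊢_v` is a split Frobenioid, whose underlying Frobenioid we denote by `‡𝒞^⊢_v`, which
admits an isomorphism `‡ℱ^⊢_v ⥲ ℱ^⊢_v` …; (b) if `v ∈ 𝕍^arc`, then `‡ℱ^⊢_v` is a triple of data, consisting
of a Frobenioid `‡𝒞^⊢_v`, an object of `𝕋𝕄^⊢`, and a splitting of the Frobenioid, such that there exists
an isomorphism of collections of data `‡ℱ^⊢_v ⥲ ℱ^⊢_v`" ([IUTchI] Def 5.2 (ii) p. 134). Kummer-blind
(Rmk 5.2.2 p. 143). ([IUTchI] Def 5.2 (ii) p.134) [claim: Mochizuki2012, status: disputed] -/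
structure FmStrip (FK : K.FKit M) where
  /-- the constituent `‡ℱ^⊢_v` -/
  obj : ∀ v, FK.FmAmb v
  /-- each constituent is an isomorph of the model `ℱ^⊢_v` -/
  isModel : ∀ v, Nonempty (obj v ≅ FK.fmModel v)

/-- "A morphism of `ℱ`- (respectively, `ℱ^⊢`-) prime-strips is defined to be a collection of
isomorphisms, indexed by `𝕍`, between the various constituent objects of the prime-strips"
([IUTchI] Def 5.2 (iii) p. 134), `ℱ` case. ([IUTchI] Def 5.2 (iii) p.134) [claim: Mochizuki2012, status: disputed] -/
def FStrip.Iso (F₁ F₂ : FK.FStrip) : Type u := ∀ v, F₁.obj v ≅ F₂.obj v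

/-- Morphisms of `ℱ^⊢`-prime-strips ([IUTchI] Def 5.2 (iii) p. 134), `ℱ^⊢` case.
([IUTchI] Def 5.2 (iii) p.134) [claim: Mochizuki2012, status: disputed] -/
def FmStrip.Iso (F₁ F₂ : FK.FmStrip) : Type u := ∀ v, F₁.obj v ≅ F₂.obj v

/-- "Following the conventions of §0, one thus has notions of capsules of `ℱ`- (respectively,
`ℱ^⊢`-) [prime-strips] and morphisms of capsules" ([IUTchI] Def 5.2 (iii) p. 134): a capsule of
`ℱ`-prime-strips with index set `T`. ([IUTchI] Def 5.2 (iii) p.134) [claim: Mochizuki2012, status: disputed] -/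
abbrev FCapsule (FK : K.FKit M) (T : Type) : Type u := T → FK.FStrip

/-! ### Rmk 5.2.1: `ℱ ↦ 𝒟`, `ℱ ↦ ℱ^⊢`, `ℱ ↦ ℱ^⊩` -/

/-- **Rmk 5.2.1 (i)**: "there exists a functorial algorithm for constructing `𝒟`- … prime-strips from
`ℱ`- … prime-strips" — the `𝒟`-prime-strip `‡𝔇` associated to `‡𝔉` ([IUTchI] Rmk 5.2.1 (i) p. 143).
([IUTchI] Rmk 5.2.1 (i) p.143) [claim: Mochizuki2012, status: disputed] -/
noncomputable def FStrip.assocD (F : FK.FStrip) : K.DStrip where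
  obj v := (FK.toD v).obj (F.obj v)
  isLocal v := ⟨(FK.toD v).mapIso (F.isModel v).some ≪≫ FK.toD_model v⟩

/-- Rmk 5.2.1 (i) on isomorphisms: the "natural map `Isom(¹𝔉, ²𝔉) → Isom(¹𝔇, ²𝔇)`" of Cor 5.3 (ii).
([IUTchI] Rmk 5.2.1 (i) p.143) [claim: Mochizuki2012, status: disputed] -/
noncomputable def FStrip.assocDMap {F₁ F₂ : FK.FStrip} (φ : F₁.Iso F₂) : F₁.assocD.Iso F₂.assocD :=
  fun v => (FK.toD v).mapIso (φ v)

/-- **Rmk 5.2.1 (ii)**: "there exists a functorial algorithm for constructing from an `ℱ`-prime-strip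
`‡𝔉` an `ℱ^⊢`-prime-strip `‡𝔉^⊢` … which we shall refer to as the mono-analyticization of `‡𝔉`" ([IUTchI]
Rmk 5.2.1 (ii) p. 143). ([IUTchI] Rmk 5.2.1 (ii) p.143) [claim: Mochizuki2012, status: disputed] -/
noncomputable def FStrip.mono (F : FK.FStrip) : FK.FmStrip where
  obj v := (FK.toFm v).obj (F.obj v)
  isModel v := ⟨(FK.toFm v).mapIso (F.isModel v).some ≪≫ FK.toFm_model v⟩

/-- Rmk 5.2.1 (i): the `𝒟^⊢`-prime-strip associated to an `ℱ^⊢`-prime-strip ([IUTchI] Rmk 5.2.1 (i)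
p. 143). ([IUTchI] Rmk 5.2.1 (i) p.143) [claim: Mochizuki2012, status: disputed] -/
def FmStrip.assocDm (F : FK.FmStrip) : M.DMono := FK.toDm F.obj

/-- Rmk 5.2.1 (i) on isomorphisms: the "natural map `Isom(¹𝔉^⊢, ²𝔉^⊢) → Isom(¹𝔇^⊢, ²𝔇^⊢)`" of Cor 5.3
(iii). ([IUTchI] Rmk 5.2.1 (i) p.143) [claim: Mochizuki2012, status: disputed] -/
def FmStrip.assocDmMap {F₁ F₂ : FK.FmStrip} (φ : F₁.Iso F₂) : F₁.assocDm ⟶ F₂.assocDm := FK.toDmMap φ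

/-! ### Def 5.2 (iv): `ℱ^⊩`-prime-strips -/

/-- An **`ℱ^⊩`-prime-strip** (globally realified mono-analytic Frobenioid-prime-strip)
`‡𝔉^⊩ = (‡𝒞^⊩, Prime(‡𝒞^⊩) ⥲ 𝕍, ‡𝔉^⊢, {‡ρ_v}_{v∈𝕍})` satisfying (a)–(e) and "(f) the collection of data in
the above display is isomorphic to the collection of data `ℱ^⊩_mod` of Example 3.5, (ii)"
([IUTchI] Def 5.2 (iv) pp. 134–135). ([IUTchI] Def 5.2 (iv) p.134) [claim: Mochizuki2012, status: disputed] -/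
structure FrStrip (FK : K.FKit M) where
  /-- the collection of data -/
  obj : FK.RlfAmb
  /-- "(f) … isomorphic to the collection of data `ℱ^⊩_mod`" -/
  isModel : Nonempty (obj ≅ FK.rlfModel)

/-- "A morphism of `ℱ^⊩`-prime-strips is defined to be an isomorphism between collections of data
as discussed above" ([IUTchI] Def 5.2 (iv) p. 135). ([IUTchI] Def 5.2 (iv) p.135) [claim: Mochizuki2012, status: disputed] -/
def FrStrip.Iso (F₁ F₂ : FK.FrStrip) : Type u := F₁.obj ≅ F₂.obj

/-- The `ℱ^⊢`-prime-strip `‡𝔉^⊢` [datum (d)] of an `ℱ^⊩`-prime-strip ([IUTchI] Def 5.2 (iv) p. 135), provided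
the interface functor preserves models (hypothesis). ([IUTchI] Def 5.2 (iv) p.135) [claim: Mochizuki2012, status: disputed] -/
def FrStrip.fmStrip (F : FK.FrStrip) (h : ∀ v, Nonempty ((FK.rlfFm v).obj FK.rlfModel ≅ FK.fmModel v)) :
    FK.FmStrip where
  obj v := (FK.rlfFm v).obj F.obj
  isModel v := ⟨(FK.rlfFm v).mapIso F.isModel.some ≪≫ (h v).some⟩

/-- **Rmk 5.2.1 (ii)**, second algorithm: "`‡𝔉 ↦ ‡𝔉^⊩ := (‡𝒞^⊩, Prime(‡𝒞^⊩) ⥲ 𝕍, ‡𝔉^⊢, {‡ρ_v}_{v∈𝕍})` … which is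
isomorphic to the collection of data `ℱ^⊩_mod` of Example 3.5, (ii), i.e., which forms an
`ℱ^⊩`-prime-strip" ([IUTchI] Rmk 5.2.1 (ii) p. 143): the printed claim that the output IS an
`ℱ^⊩`-prime-strip, as a named statement over the interface (the model `ℱ`-prime-strip maps to an
isomorph of `ℱ^⊩_mod`). ([IUTchI] Rmk 5.2.1 (ii) p.143) [claim: Mochizuki2012, status: disputed] -/
def RlfOfIsStrip (FK : K.FKit M) : Prop := ∀ F : FK.FStrip, Nonempty (FK.rlfOf F.obj ≅ FK.rlfModel)

/-- The `ℱ^⊩`-prime-strip `‡𝔉^⊩` associated to `‡𝔉` by Rmk 5.2.1 (ii), given the printed claim.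
([IUTchI] Rmk 5.2.1 (ii) p.143) [claim: Mochizuki2012, status: disputed] -/
def FStrip.rlf (h : FK.RlfOfIsStrip) (F : FK.FStrip) : FK.FrStrip := ⟨FK.rlfOf F.obj, h F⟩

/-! ### Corollary 5.3 (ii)–(iv) -/

/-- **Cor 5.3 (ii)**: "For `i = 1, 2`, let `ⁱ𝔉` be an `ℱ`-prime-strip; `ⁱ𝔇` the `𝒟`-prime-strip associated
to `ⁱ𝔉`. Then the natural map `Isom(¹𝔉, ²𝔉) → Isom(¹𝔇, ²𝔇)` is bijective" ([IUTchI] Cor 5.3 (ii) p. 144;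
proof via [AbsTopIII] Prop 3.2 (iv), 4.2 (i)) — named statement, NOT asserted.
([IUTchI] Cor 5.3 (ii) p.144) [claim: Mochizuki2012, status: disputed] -/
def IsomFtoDBijective (FK : K.FKit M) : Prop :=
  ∀ F₁ F₂ : FK.FStrip, Function.Bijective (FStrip.assocDMap (FK := FK) (F₁ := F₁) (F₂ := F₂))

/-- **Cor 5.3 (iii)**: "For `i = 1, 2`, let `ⁱ𝔉^⊢` be an `ℱ^⊢`-prime-strip; `ⁱ𝔇^⊢` the `𝒟^⊢`-prime-strip
associated to `ⁱ𝔉^⊢`. Then the natural map `Isom(¹𝔉^⊢, ²𝔉^⊢) → Isom(¹𝔇^⊢, ²𝔇^⊢)` is surjective" ([IUTchI]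
Cor 5.3 (iii) p. 144; proof via [AbsTopIII] Prop 5.8 (ii), (v)) — named statement, NOT asserted.
([IUTchI] Cor 5.3 (iii) p.144) [claim: Mochizuki2012, status: disputed] -/
def IsomFmtoDmSurjective (FK : K.FKit M) : Prop :=
  ∀ F₁ F₂ : FK.FmStrip, Function.Surjective (FmStrip.assocDmMap (FK := FK) (F₁ := F₁) (F₂ := F₂))

/-- **Cor 5.3 (iv)**: "Let `v ∈ 𝕍^bad`. Recall the category `ℱ̲_v` of Example 3.2, (i). Thus, `ℱ̲_v` is
equipped with a natural Frobenioid structure, with base category `𝒟_v`. Then the natural homomorphism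
`Aut(ℱ̲_v) → Aut(𝒟_v)` is bijective" ([IUTchI] Cor 5.3 (iv) p. 144; proof pp. 144–145 via [EtTh]
cyclotomic rigidity and [FrdI] Thm 5.2, Prop 5.6) — named statement over the base functor of the
interface at `v`, NOT asserted. ([IUTchI] Cor 5.3 (iv) p.144) [claim: Mochizuki2012, status: disputed] -/
def AutTemperedBijective (FK : K.FKit M) : Prop :=
  ∀ v ∈ K.bad, Function.Bijective fun α : Aut (FK.thModel v) => (FK.thToF v ⋙ FK.toD v).mapIso α

/-! ### Θ-Hodge theaters (Def 3.6; TODO-merge:abc-iut-L5-t2) and Cor 5.6 (i) -/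

/-- A **Θ-Hodge theater** `†ℋ𝒯^Θ = ({†ℱ̲_v}_{v∈𝕍}, †𝔉^⊩_mod)` ([IUTchI] Def 3.6 p. 87, abc-iut-L5-t2's;
minimal local version, TODO-merge:abc-iut-L5-t2): local data `†ℱ̲_v` isomorphic to the models of
Examples 3.2 (i), 3.3 (i), 3.4 (i), and a global realified datum `†𝔉^⊩_mod` "such that there exist[s] an
isomorphism of collections of data `†𝔉^⊩_mod ⥲ 𝔉^⊩_mod`", whose `ℱ^⊢`-prime-strip is the one determined by
the `†ℱ̲_v` (Def 3.6 (c): "`†ℱ^⊢_v` is as discussed in (a), (b) above").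
([IUTchI] Def 3.6 p.87) [claim: Mochizuki2012, status: disputed] -/
structure ThetaHT (FK : K.FKit M) where
  /-- the local data `†ℱ̲_v` -/
  th : ∀ v, FK.ThAmb v
  /-- each is an isomorph of the model -/
  th_isModel : ∀ v, Nonempty (th v ≅ FK.thModel v)
  /-- the global realified datum `†𝔉^⊩_mod` -/
  rlf : FK.RlfAmb
  /-- it is an isomorph of `𝔉^⊩_mod` -/
  rlf_isModel : Nonempty (rlf ≅ FK.rlfModel)
  /-- its `ℱ^⊢`-prime-strip is the mono-analyticization of the local data -/
  rlf_fm : ∀ v, (FK.rlfFm v).obj rlf ≅ (FK.toFm v).obj ((FK.thToF v).obj (th v))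

/-- An isomorphism of Θ-Hodge theaters ([IUTchI] Rmk 3.6.2; Cor 5.6 (i)): isomorphisms of all the
constituent data (compatibility with `rlf_fm` is the evident condition, recorded as `compat`).
([IUTchI] Cor 5.6 (i) p.153) [claim: Mochizuki2012, status: disputed] -/
structure ThetaHT.Iso (H₁ H₂ : FK.ThetaHT) where
  /-- on the local data -/
  thIso : ∀ v, H₁.th v ≅ H₂.th v
  /-- on the global realified data -/
  rlfIso : H₁.rlf ≅ H₂.rlf
  /-- compatibility of the two through the `ℱ^⊢`-prime-strips -/
  compat : ∀ v, (FK.rlfFm v).map rlfIso.hom ≫ (H₂.rlf_fm v).hom =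
    (H₁.rlf_fm v).hom ≫ (FK.toFm v).map ((FK.thToF v).map (thIso v).hom)

/-- `†𝔉_>`: "the `ℱ`-prime-strip tautologically associated to this Θ-Hodge theater" ([IUTchI] p. 147,
discussion preceding Example 5.4). ([IUTchI] Ex 5.4 p.147) [claim: Mochizuki2012, status: disputed] -/
noncomputable def ThetaHT.fStrip (H : FK.ThetaHT) : FK.FStrip where
  obj v := (FK.thToF v).obj (H.th v)
  isModel v := ⟨(FK.thToF v).mapIso (H.th_isModel v).some ≪≫ FK.thToF_model v⟩

/-- "Thus, `†𝔇_>` may be identified with the `𝒟`-prime-strip associated to `†𝔉_>`" ([IUTchI] p. 147).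
([IUTchI] Ex 5.4 p.147) [claim: Mochizuki2012, status: disputed] -/
noncomputable def ThetaHT.dStrip (H : FK.ThetaHT) : K.DStrip := H.fStrip.assocD

/-- The "natural functorially induced map from the set of isomorphisms between two Θ-Hodge theaters to
the set of isomorphisms between the respective associated `𝒟`-prime-strips" ([IUTchI] Cor 5.6 (i)
p. 153). ([IUTchI] Cor 5.6 (i) p.153) [claim: Mochizuki2012, status: disputed] -/
noncomputable def ThetaHT.isoToD {H₁ H₂ : FK.ThetaHT} (φ : ThetaHT.Iso H₁ H₂) : H₁.dStrip.Iso H₂.dStrip :=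
  fun v => (FK.thToF v ⋙ FK.toD v).mapIso (φ.thIso v)

/-! ### Remark 5.3.1: morphisms of `ℱ`-prime-strips lying over morphisms of `𝒟`-prime-strips -/

/-- **Rmk 5.3.1 (i)**: for a poly-morphism `Φ` of `𝒟`-prime-strips between the `𝒟`-prime-strips
associated to `ℱ`-prime-strips `¹𝔉`, `²𝔉`, "the uniquely determined [poly-]morphism that lies over `φ`"
([IUTchI] Rmk 5.3.1 (i) pp. 145–146: "by Corollary 5.3, (ii), it follows that [`φ`] uniquely determines
an isomorphism `¹𝔉 ⥲ φ^*(²𝔉)` … we refer to `ψ` as the 'morphism uniquely determined by `φ`'"): the set of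
isomorphisms of `ℱ`-prime-strips whose associated isomorphism of `𝒟`-prime-strips lies in `Φ` (for
poly-isomorphisms; the pulled-back strip `φ^*(²𝔉)` for a non-isomorphic `φ` — Rmk 5.3.1's categorical
fiber product [FrdI] Prop 1.6 — is not materialised here); (ii) "may also be applied to
poly-morphisms". ([IUTchI] Rmk 5.3.1 pp.145-146) [claim: Mochizuki2012, status: disputed] -/
def liftPoly {F₁ F₂ : FK.FStrip} (Φ : Set (F₁.assocD.Iso F₂.assocD)) : Set (F₁.Iso F₂) :=
  {ψ | FStrip.assocDMap ψ ∈ Φ}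

/-- Under Cor 5.3 (ii), the lift of a poly-isomorphism maps bijectively onto it ("lifts uniquely").
PROVED from the named statement `IsomFtoDBijective`.
([IUTchI] Rmk 5.3.1 (i) p.146) [claim: Mochizuki2012, status: disputed] -/
theorem liftPoly_bijOn (h : FK.IsomFtoDBijective) {F₁ F₂ : FK.FStrip} (Φ : Set (F₁.assocD.Iso F₂.assocD)) :
    Set.BijOn FStrip.assocDMap (liftPoly Φ) Φ := by
  refine ⟨fun ψ hψ => hψ, fun ψ₁ _ ψ₂ _ heq => (h F₁ F₂).1 heq, fun φ hφ => ?_⟩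
  obtain ⟨ψ, rfl⟩ := (h F₁ F₂).2 φ
  exact ⟨ψ, hφ, rfl⟩

end FKit

/-! ### Consistency: a model of `FKit` over the toy base kit -/

/-- A model of the `ℱ`-prime-strip kit over `PMBaseKit.toyKit` (prime `l ≠ 2`): all Frobenioid-side
ambient categories are the collage category `Model.Obj l` with identity functors to the base, the
`ℱ^⊩` category is the product over `𝕍`, and the `𝒟^⊢` side is `MultKit.toy` — witnessing that `FKit` has
honest inhabitants ([IUTchI] Def 5.2 (i) p. 134). ([IUTchI] Def 5.2 (i) p.134) [claim: Mochizuki2012, status: disputed] -/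
noncomputable def FKit.toy (l : ℕ) [Fact l.Prime] (hl : l ≠ 2) : (toyKit l hl).FKit (MultKit.toy l hl) where
  FAmb _ := Model.Obj l
  fModel _ := Model.Obj.loc
  FmAmb _ := Model.Obj l
  fmModel _ := Model.Obj.loc
  toD _ := 𝟭 _
  toD_model _ := Iso.refl _
  toFm _ := 𝟭 _
  toFm_model _ := Iso.refl _
  RlfAmb := ∀ _ : (toyKit l hl).V, Model.Obj l
  rlfModel := fun _ => Model.Obj.loc
  rlfFm v := Pi.eval _ v
  rlfOf F := F
  rlfOfMap φ := Pi.isoMk φ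
  rlfFm_rlfOf _ _ := Iso.refl _
  ThAmb _ := Model.Obj l
  thModel _ := Model.Obj.loc
  thToF _ := 𝟭 _
  thToF_model _ := Iso.refl _
  toDm _ := SingleObj.star _
  toDmMap _ := 𝟙 _
  toDm_toFm _ _ := ⟨𝟙 _⟩

end PMBaseKit

end Literature.IUT.HodgeTheaters
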